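/-
Copyright (c) 2024 Kevin Buzzard. All rights reserved.
Released under Apache 2.0 license as described in the file LICENSE.
Authors: Kevin Buzzard, Salvatore Mercuri, Pietro Monticone
-- (for the material from `FLT/Mathlib/Topology/Algebra/Module/Equiv.lean`)

Copyright (c) 2024 Kevin Buzzard. All rights reserved.
Released under Apache 2.0 license as described in the file LICENSE.
Authors: Kevin Buzzard, Salvatore Mercuri
-- (for the material from `FLT/NumberField/InfiniteAdeleRing.lean`)

Copyright (c) 2025 Kevin Buzzard. All rights reserved.
Released under Apache 2.0 license as described in the file LICENSE.
Authors: Kevin Buzzard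
-- (for the lemma from `FLT/Mathlib/NumberTheory/NumberField/InfiniteAdeleRing.lean`)

Vendored into this tree (Lean v4.32.0 / Mathlib v4.32.0) from the FLT project,
ImperialCollegeLondon/FLT @ 071d16bb51e87165b4f4b5466f14051344bf426b (2026-08-18), Apache-2.0
[FLTProject2025]. Modifications: see the module docstring ("Provenance and modifications").
-/
import Mathlib.LinearAlgebra.Determinant
import Mathlib.LinearAlgebra.Matrix.ToLinearEquiv
import Mathlib.NumberTheory.NumberField.InfiniteAdeleRing
import Mathlib.RingTheory.TensorProduct.Pi
import Mathlib.Topology.Algebra.Module.ModuleTopology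
import Literature.NumberTheory.AdelicBaseChange.RestrictedProductModule
import Literature.NumberTheory.AdelicBaseChange.InfinitePlaceBaseChange
import HarnessLib

/-!
# Base change of the infinite adele ring: `L ⊗[K] K_∞ ≃A[L] L_∞` (T6)

Topic `NumberTheory/AdelicBaseChange` — file 14 of the ADELIC BASE-CHANGE PACKET (the FLT project's
proof of `L ⊗[K] K_v ≃ₐ[L] ∏_{w ∣ v} L_w`, `L ⊗[K] 𝔸_K^∞ ≃ₐ[L] 𝔸_L^∞`, `L ⊗[K] 𝔸_K ≃ₐ[L] 𝔸_L`,
vendored module by module; Cassels–Fröhlich, *Algebraic Number Theory*, Ch. II §10, §14): the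
archimedean part of Cassels–Fröhlich Ch. II §14 Lemma (14.2), assembled from file 13 (the local
isomorphisms `L ⊗[K] K_v ≃A[L] Π_{w∣v} L_w`) and file 11 (`Pi.FiberwiseSMul`,
`LinearEquiv.piScalarPiCongrFiberwise`/`piScalarPiComm`). FLT modules, each in its own `section`:

* from `FLT/Mathlib/Topology/Algebra/Module/Equiv.lean`: the product-scalar continuous linear
  equivalences `ContinuousLinearEquiv.piScalarPiCongrFiberwise`, `ContinuousLinearEquiv.piScalarPiComm`,
  and `ContinuousLinearEquiv.toContinuousAddEquiv_apply` (used by file 15);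
* from `FLT/Mathlib/NumberTheory/NumberField/InfiniteAdeleRing.lean`: nothing is declared — its one
  lemma used by the base change, `NumberField.InfiniteAdeleRing.mul_apply` (`(x * y) v = x v * y v`,
  `rfl`), already exists in the tree as
  `Literature.NumberTheory.GaloisRepresentations.InfiniteAdeleRing.mul_apply'`
  (`GaloisRepresentations/AlgebraicHeckeCharacterGrossencharakterProofs.lean`, too heavy to import for a
  `rfl` lemma; gate de-duplication rule), so the one FLT proof that used it through `simp` (the
  `IsBiscalar L K∞` instance) states it as a local `have` instead;
* `FLT/NumberField/InfiniteAdeleRing.lean` (all of it): the base change map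
  `NumberField.InfiniteAdeleRing.baseChange : K∞ →SA[algebraMap K L] L∞` (componentwise `comapHom`),
  `piEquiv : K_∞^[L:K] ≃L[K_∞] L_∞`, the instance **`IsModuleTopology K∞ L∞`** (for a fiberwise
  `Algebra K∞ L∞`), **`baseChangeAlgEquiv : L ⊗[K] K∞ ≃ₐ[L] L∞`** with `baseChangeAlgEquiv_tmul`,
  `Module.Free K∞ (L ⊗[K] K∞)`, the `IsBiscalar L K∞` instance, and **`baseChangeEquiv :
  L ⊗[K] K∞ ≃A[L] L∞`**.

NOT vendored (unused by the base change): the rest of `FLT/Mathlib/Topology/Algebra/Module/Equiv.lean`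
(`Matrix.toContinuousLinearEquiv` and the determinant lemmas — FLT's Haar-character toolkit), the rest
of `FLT/Mathlib/NumberTheory/NumberField/InfiniteAdeleRing.lean` (`ℝ`-structure of `K_∞`, `≅` mixed
space, `IsModuleTopology ℝ ℂ`, …) and `…/InfinitePlace/Completion.lean` (second countability), which
FLT's file imports only for material outside this packet.

Relation to the tree: `Literature/NumberTheory/Automorphic/AdeleBaseChange.lean` has the MAP
`Literature.NumberTheory.Automorphic.InfiniteAdeleRing.baseChange : InfiniteAdeleRing F →+* InfiniteAdeleRing E`
(componentwise, via Mathlib's `LiesOver` completion maps) and its injectivity; the isomorphism statements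
here are new to the tree.

Everything is PROVED (definitions/instances with bodies + lemmas); no named facts. The T6 headlines
carry `[cite: CasselsFrohlichANT1967, Ch. II §14 Lemma (14.2)]`; every declaration carries the
provenance tag `[cite: FLTProject2025, FLT/<file> · <FLT name>]`.

## Provenance and modifications (Apache-2.0 §4)

Lean sources: the three FLT files named above, of ImperialCollegeLondon/FLT at commit `071d16bb51e8`
(branch `main`, 2026-08-18; Lean v4.34.0-rc1 / Mathlib `274ed6d6`), each in its own `section`.
Modifications made here: (1) back-port to Mathlib v4.32.0 (FLT-INVENTORY §3.2 probe E rule table):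
`module`/`public import`/`@[expose] public section` removed; the notation `K∞` for
`NumberField.InfiniteAdeleRing K`, which FLT takes from its newer Mathlib, is declared at the top of
this file exactly as Mathlib master declares it (`scoped[NumberField.AdeleRing] notation:max K "∞"`)
— delete it at the Mathlib bump that brings it; (2) the omissions listed above, and the local `have hmul` replacing FLT's `InfiniteAdeleRing.mul_apply` in the
`IsBiscalar` instance; (3) docstrings and
provenance tags added to every declaration (FLT's own kept; the T6 headlines expanded with the
Cassels–Fröhlich locator); the original copyright headers are kept above; unused FLT imports dropped.
NAMESPACES (CONVENTIONS §2, reviews p318962/p319167): this file has no FLT root-level declarations (the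
packet namespace `Literature.NumberTheory.AdelicBaseChange` is opened at the top, as in every packet
file); FLT's deliberate extensions of MATHLIB namespaces — here `ContinuousLinearEquiv`,
`NumberField.InfiniteAdeleRing` — keep their absolute names for dot notation, and each such docstring
says so. Short names are FLT's throughout (including FLT's explicit instance name
`instIsModuleTopology_fLT`), so that file 15, and an eventual Mathlib bump absorbing FLT's
upstreaming, need no renaming; none of them exists in Mathlib v4.32.0 or in the tree.

## References
* K. Buzzard, R. Taylor et al., *FLT* (Lean 4 project), Imperial College London, 2025–. [FLTProject2025]
* J. W. S. Cassels, A. Fröhlich (eds.), *Algebraic Number Theory*, Academic Press, 1967, Ch. II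
  (Cassels, *Global fields*) §14 "Adele ring", Lemma (14.2), p. 64. [CasselsFrohlichANT1967]
-/

namespace NumberField

/-- `K∞` is notation for `NumberField.InfiniteAdeleRing K` (as in Mathlib master; absent at Mathlib
v4.32.0 — back-port shim, FLT-INVENTORY §3.2 probe E).
[cite: FLTProject2025, back-port shim for the Mathlib notation `K∞`] -/
scoped[NumberField.AdeleRing] notation:max K "∞" => NumberField.InfiniteAdeleRing K

end NumberField

namespace Literature.NumberTheory.AdelicBaseChange
-- the packet namespace (CONVENTIONS §2): FLT-root declarations below live in it; it is opened here so
-- that FLT's cross-references between them and its Mathlib-namespace extensions resolve unchanged.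
end Literature.NumberTheory.AdelicBaseChange

open Literature.NumberTheory.AdelicBaseChange

/-! ## From `FLT/Mathlib/Topology/Algebra/Module/Equiv.lean` -/

section

/-- Let `f : α → β` be a function on index types. A family of `R b`-linear homeomorphisms, indexed
by `b : β`, between the product over the fiber of `b` under `f` given as
`∀ (σ : { a : α // f a = b }) → γ₁ σ.1) ≃ₗ[R b] γ₂ b` lifts to an equivalence over the products
`∀ a, γ₁ a ≃ₗ[∀ b, R b] ∀ b, γ₂ b` with product scalars `∀ b, R b`, provided that `∀ b, R b` acts on
`∀ a, γ₁ a` fiberwise. This is `Equiv.piCongrFiberwise` as a `ContinuousLinearEquiv` with product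
scalars.
(In Mathlib's namespace `ContinuousLinearEquiv`: a deliberate extension under FLT's name, for dot
notation and so that the later packet files apply unchanged — CONVENTIONS §2.)
[cite: FLTProject2025, FLT/Mathlib/Topology/Algebra/Module/Equiv.lean · ContinuousLinearEquiv.piScalarPiCongrFiberwise] -/
def ContinuousLinearEquiv.piScalarPiCongrFiberwise {α : Type*} {β : Type*} {R : β → Type*}
    {γ₁ : α → Type*} {γ₂ : β → Type*} {f : α → β} [(a : α) → TopologicalSpace (γ₁ a)]
    [(b : β) → TopologicalSpace (γ₂ b)] [(b : β) → Semiring (R b)] [(a : α) → AddCommMonoid (γ₁ a)]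
    [(b : β) → AddCommMonoid (γ₂ b)] [(b : β) → (a : { a : α // f a = b }) → Module (R b) (γ₁ a)]
    [(b : β) → Module (R b) (γ₂ b)] [Module ((b : β) → R b) ((a : α) → γ₁ a)]
    [Pi.FiberwiseSMul f R γ₁]
    (e : (b : β) → ((σ : { a : α // f a = b }) → γ₁ σ.1) ≃L[R b] γ₂ b) :
    ((a : α) → γ₁ a) ≃L[∀ b, R b] ((b : β) → γ₂ b) where
  __ := LinearEquiv.piScalarPiCongrFiberwise fun b => (e b).toLinearEquiv
  continuous_invFun := by
    change Continuous (fun (g : (b : β) → γ₂ b) a ↦ (e (f a)).symm (g (f a)) ⟨a, rfl⟩)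
    fun_prop
  continuous_toFun := by
    change Continuous (fun (x : (a : α) → γ₁ a) ↦
      Pi.map (fun a ↦ ⇑(e a)) fun _ y ↦ (fun _ ↦ x _) _)
    fun_prop

/-- Given `φ : α → β → Type*` and `R : α → Type*` such that `φ a b` is an `R a` module for all
`a b`, this is the continuous linear equivalence between `∀ a b, φ a b` and `∀ b a, φ a b` with
product scalars. This is `Equiv.piComm` as a product-scalar `ContinuousLinearEquiv`.
(In Mathlib's namespace `ContinuousLinearEquiv`: a deliberate extension under FLT's name, for dot
notation and so that the later packet files apply unchanged — CONVENTIONS §2.)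
[cite: FLTProject2025, FLT/Mathlib/Topology/Algebra/Module/Equiv.lean · ContinuousLinearEquiv.piScalarPiComm] -/
def ContinuousLinearEquiv.piScalarPiComm {α β : Type*} (R : α → Type*) (φ : α → β → Type*)
    [(a : α) → Semiring (R a)] [(a : α) → (b : β) → AddCommMonoid (φ a b)]
    [(a : α) → (b : β) → Module (R a) (φ a b)] [(a : α) → (b : β) → TopologicalSpace (φ a b)] :
    ((a : α) → (b : β) → φ a b) ≃L[∀ a, R a] ((b : β) → (a : α) → φ a b) where
  __ := LinearEquiv.piScalarPiComm R φ
  continuous_toFun := by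
    change Continuous (fun (x : (a : α) → (b : β) → φ a b) ↦ Function.swap x)
    fun_prop
  continuous_invFun := by
    change Continuous (fun x ↦ Function.swap x)
    fun_prop

-- (OMITTED here, unused by the base change: `ContinuousLinearEquiv.toContinuousAddEquiv_trans`,
-- `toMatrix_isUnit_det`/`toMatrix_isUnit`/`toMatrix_det_ne_zero`, `Matrix.toContinuousLinearEquiv` and its
-- lemmas, `ContinuousLinearEquiv.toMatrix_toContinousLinearEquiv` — FLT's Haar-character toolkit.)

/-- The continuous additive equivalence underlying `f : M ≃L[R] N` acts as `f`.
(In Mathlib's namespace `ContinuousLinearEquiv`: a deliberate extension under FLT's name, for dot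
notation and so that the later packet files apply unchanged — CONVENTIONS §2.)
[cite: FLTProject2025, FLT/Mathlib/Topology/Algebra/Module/Equiv.lean · ContinuousLinearEquiv.toContinuousAddEquiv_apply] -/
theorem ContinuousLinearEquiv.toContinuousAddEquiv_apply {R : Type*} {M N : Type*}
    [Semiring R] [TopologicalSpace M] [TopologicalSpace N] [AddCommMonoid M] [AddCommMonoid N]
    [Module R M] [Module R N]
    (f : M ≃L[R] N) (m : M) : f.toContinuousAddEquiv m = f m := rfl


end

/-! ## From `FLT/Mathlib/NumberTheory/NumberField/InfiniteAdeleRing.lean` — nothing declared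

FLT's `NumberField.InfiniteAdeleRing.mul_apply` is NOT re-declared: the tree has the statement as
`Literature.NumberTheory.GaloisRepresentations.InfiniteAdeleRing.mul_apply'` (see the module docstring);
the rest of this FLT file — `T2Space`/`SecondCountableTopology`/`Algebra ℝ`/`IsModuleTopology ℝ`
structure of `K_∞`, `algEquivMixedSpace`, `continuousAlgEquivMixedSpace`, `IsModuleTopology ℝ ℂ`,
`Rat.infinitePlaceCompletionContinuousAlgEquiv` — is OMITTED: unused by the base change. -/

/-! ## From `FLT/NumberField/InfiniteAdeleRing.lean` -/

section

variable (K L : Type*) [Field K] [Field L] [Algebra K L]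

open NumberField InfinitePlace SemialgHom

open scoped TensorProduct

namespace NumberField.InfiniteAdeleRing

open scoped NumberField.AdeleRing

/-- The canonical map from the infinite adeles of K to the infinite adeles of L
(In Mathlib's namespace `NumberField.InfiniteAdeleRing`: a deliberate extension under FLT's name,
for dot notation and so that the later packet files apply unchanged — CONVENTIONS §2.)
[cite: FLTProject2025, FLT/NumberField/InfiniteAdeleRing.lean · NumberField.InfiniteAdeleRing.baseChange] -/
noncomputable def baseChange :
    K∞ →SA[algebraMap K L] L∞ where
  __ := Pi.semialgHomPi _ _ fun _ => Completion.comapHom rfl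
  continuous_toFun := .piSemialgHomPi Completion Completion _ fun _ => Completion.comapHom_cont rfl

/-- Components of the base change `K_∞ → L_∞`: `(baseChange x) w = ι_w (x v)` with `v = w.comap
(algebraMap K L)`.
(In Mathlib's namespace `NumberField.InfiniteAdeleRing`: a deliberate extension under FLT's name,
for dot notation and so that the later packet files apply unchanged — CONVENTIONS §2.)
[cite: FLTProject2025, FLT/NumberField/InfiniteAdeleRing.lean · NumberField.InfiniteAdeleRing.baseChange_apply] -/
@[simp]
theorem baseChange_apply (x : K∞) (w : InfinitePlace L) :
    baseChange K L x w = Completion.comapHom (w := w) rfl (x (w.comap (algebraMap K L))) := rfl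

open scoped TensorProduct.RightActions

/-- An `Algebra K_∞ L_∞` instance (a section variable: users supply it, e.g. from `baseChange`)
transported to the underlying products `Π_v K_v`, `Π_w L_w`. (In Mathlib's namespace `NumberField.InfiniteAdeleRing`: a deliberate extension under FLT's name, for dot notation and so that the later packet files apply unchanged — CONVENTIONS §2.) -/
noncomputable instance [Algebra K∞ L∞] :
    Algebra ((v : InfinitePlace K) → v.Completion) ((w : InfinitePlace L) → w.Completion) :=
  inferInstanceAs (Algebra K∞ L∞)

/-! Show that `L_∞` has the `K_∞`-module topology. -/

open scoped NumberField.LiesOver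

variable [NumberField K] [NumberField L]

/-- The $K_{\infty}$-linear homeomorphism $K_{\infty}^{[L:K]} \cong L_{\infty}$.
(In Mathlib's namespace `NumberField.InfiniteAdeleRing`: a deliberate extension under FLT's name,
for dot notation and so that the later packet files apply unchanged — CONVENTIONS §2.)
[cite: FLTProject2025, FLT/NumberField/InfiniteAdeleRing.lean · NumberField.InfiniteAdeleRing.piEquiv] -/
noncomputable def piEquiv [Algebra K∞ L∞]
    [Pi.FiberwiseSMul (fun a : InfinitePlace L => a.comap (algebraMap K L)) Completion Completion] :
    (Fin (Module.finrank K L) → K∞) ≃L[K∞] L∞ :=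
  have := (ContinuousLinearEquiv.piScalarPiComm Completion fun v _ ↦ v.Completion).symm.trans
    -- lift the equivalence K_v^d ≃[v.Completion] ∏ w ∣ v, L_w on fibers of comap
    (ContinuousLinearEquiv.piScalarPiCongrFiberwise
      fun v : InfinitePlace K ↦ (Completion.piEquiv L v).symm).symm
  this

/-- **`L_∞` carries the `K_∞`-module topology** (for an `Algebra K_∞ L_∞` acting fiberwise over `w
↦ v`), transported along `piEquiv : K_∞^[L:K] ≃L[K_∞] L_∞`. FLT's own (explicit) instance name.
(In Mathlib's namespace `NumberField.InfiniteAdeleRing`: a deliberate extension under FLT's name,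
for dot notation and so that the later packet files apply unchanged — CONVENTIONS §2.)
[cite: FLTProject2025, FLT/NumberField/InfiniteAdeleRing.lean · NumberField.InfiniteAdeleRing.instIsModuleTopology_fLT] -/
instance instIsModuleTopology_fLT [Algebra K∞ L∞]
    [Pi.FiberwiseSMul (fun a => a.comap (algebraMap K L)) Completion Completion] :
    IsModuleTopology K∞ L∞ := .iso (piEquiv K L)

/-! Prove base change as a `L`-algebra homeomorphism. -/

-- First establish the map as an `L`-algebra isomorphism by lifting the established
-- equivalences for infinite completions of `K` and the product over all `w` lying above `v`
open scoped Classical in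
/-- **Infinite-adelic base change (T6).** The `L`-algebra isomorphism `L ⊗[K] K_∞ ≅ L_∞` for number
fields `L/K` — the archimedean part of Cassels–Fröhlich, Ch. II §14 Lemma (14.2) "`V_k ⊗_k K = V_K`",
assembled from the local isomorphisms of file 13 (`L ⊗[K] K_v ≅ Π_{w∣v} L_w`) through
`L ⊗[K] Π_v K_v ≅ Π_v (L ⊗[K] K_v)` (`Algebra.TensorProduct.piRight`, `L/K` finite) and the
regrouping `AlgEquiv.piCongrFiberwise` (file 2). Lean statement and proof: the FLT project,
`FLT/NumberField/InfiniteAdeleRing.lean` · `NumberField.InfiniteAdeleRing.baseChangeAlgEquiv`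
[FLTProject2025].
(In Mathlib's namespace `NumberField.InfiniteAdeleRing`: a deliberate extension under FLT's name,
for dot notation and so that the later packet files apply unchanged — CONVENTIONS §2.)
[cite: CasselsFrohlichANT1967, Ch. II §14 Lemma (14.2), archimedean places] -/
noncomputable def baseChangeAlgEquiv :
    L ⊗[K] K∞ ≃ₐ[L] L∞ :=
  -- L ⊗ K_∞ ≃[K_∞] ∏ v, L ⊗ K_v
  Algebra.TensorProduct.piRight K L L Completion |>.trans
    -- lift the established equivalence L ⊗ K_v ≃[v.Completion] ∏ w ∣ v, L_w on fibers of comap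
    (AlgEquiv.piCongrFiberwise
      (fun v : InfinitePlace K => (Completion.baseChangeEquiv L v).toAlgEquiv.symm)).symm

/-- `baseChangeAlgEquiv (l ⊗ x) = l · baseChange x` in `L_∞`.
(In Mathlib's namespace `NumberField.InfiniteAdeleRing`: a deliberate extension under FLT's name,
for dot notation and so that the later packet files apply unchanged — CONVENTIONS §2.)
[cite: FLTProject2025, FLT/NumberField/InfiniteAdeleRing.lean · NumberField.InfiniteAdeleRing.baseChangeAlgEquiv_tmul] -/
theorem baseChangeAlgEquiv_tmul (l : L) (x : K∞) :
    baseChangeAlgEquiv K L (l ⊗ₜ[K] x) = algebraMap _ _ l * baseChange K L x := rfl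

open TensorProduct.AlgebraTensorModule in
/-- `L ⊗[K] K_∞` is a free `K_∞`-module (`≅ K_∞ ⊗[K] L ≅ K_∞^[L:K]`). (In Mathlib's namespace `NumberField.InfiniteAdeleRing`: a deliberate extension under FLT's name, for dot notation and so that the later packet files apply unchanged — CONVENTIONS §2.) -/
instance : Module.Free K∞ (L ⊗[K] K∞) := by
  --  L ⊗ K_∞ ≃ₗ[K_∞] K_∞ ⊗ L
  let e₁ := (TensorProduct.RightActions.Algebra.TensorProduct.comm K K∞ L).toLinearEquiv.symm
  --  K_∞ ⊗ L ≃ₗ[K_∞] ∏ v, K_v ⊗ L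
  let e₂ := finiteEquivPi K L K∞
  -- Compose to transfer freeness of ∏ v, K_v ⊗ L to L ⊗ K_∞
  exact Module.Free.of_equiv (e₁.trans e₂).symm

set_option backward.isDefEq.respectTransparency false in
/-- Take two arbitrary `Algebra K L∞` and `Algebra K∞ L∞` instances. Assume that
`Algebra K L∞` factors through (existing) `Algebra K L` and `Algebra L L∞`.
Assume further that `Algebra K∞ L∞` is determined by the fibers of restriction of infinite places
of `L` to `K` via (x • y) v = x (v.comap (algebraMap K L)) • y v. Then the `L` algebra base change
map is also linear in `K∞`. (In Mathlib's namespace `NumberField.InfiniteAdeleRing`: a deliberate extension under FLT's name, for dot notation and so that the later packet files apply unchanged — CONVENTIONS §2.) -/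
instance [Algebra K∞ L∞]
    [Pi.FiberwiseSMul (fun a => a.comap (algebraMap K L)) Completion Completion] :
    IsBiscalar L K∞ (baseChangeAlgEquiv K L).toAlgHom where
  map_smul₁ l x := (InfiniteAdeleRing.baseChangeAlgEquiv K L).toAlgHom.map_smul_of_tower l x
  map_smul₂ a x := by
    induction x using TensorProduct.induction_on with
    | zero => simp
    | tmul l r =>
        funext w
        -- `hmul` = FLT's simp lemma `NumberField.InfiniteAdeleRing.mul_apply` (not re-declared in
        -- this tree, which has it as `…GaloisRepresentations.InfiniteAdeleRing.mul_apply'` in a file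
        -- too heavy to import here); stated locally so that FLT's `simp` call applies otherwise verbatim.
        have hmul (x y : L∞) (v : InfinitePlace L) : (x * y) v = x v * y v := rfl
        simp [hmul, TensorProduct.smul_tmul', baseChangeAlgEquiv_tmul,
          Pi.FiberwiseSMul.map_smul _ _ Completion (σ := w.toExtension K), RingHom.smul_toAlgebra,
          Completion.comapHom]
        ring
    | add x y _ _ => simp_all

-- `IsModuleTopology.continuousAlgEquivOfIsScalarTower` is then applicable in the same
-- way it was for `baseChangeEquiv` in `InfinitePlace.Completion`

/-- **Infinite-adelic base change, topological form (T6).** The canonical `L`-algebra HOMEOMORPHISM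
`L ⊗[K] K_∞ ≃A[L] L_∞` induced by the base change map `K_∞ → L_∞`, `L ⊗[K] K_∞` carrying the
`K_∞`-module topology and `Algebra K_∞ L_∞` acting fiberwise — the "and topologically" clause of
Cassels–Fröhlich, Ch. II §14 Lemma (14.2) at the archimedean places. Lean statement and proof: the
FLT project, `FLT/NumberField/InfiniteAdeleRing.lean` · `NumberField.InfiniteAdeleRing.baseChangeEquiv`
[FLTProject2025] (`IsModuleTopology.continuousAlgEquivOfIsBiscalar`, file 3, applied to
`baseChangeAlgEquiv`, which is `K_∞`-linear by the `IsBiscalar` instance above).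
(In Mathlib's namespace `NumberField.InfiniteAdeleRing`: a deliberate extension under FLT's name,
for dot notation and so that the later packet files apply unchanged — CONVENTIONS §2.)
[cite: CasselsFrohlichANT1967, Ch. II §14 Lemma (14.2), topological clause, archimedean places] -/
noncomputable
def baseChangeEquiv [Algebra K∞ L∞]
    [Pi.FiberwiseSMul (fun a => a.comap (algebraMap K L)) Completion Completion] :
    L ⊗[K] K∞ ≃A[L] L∞ :=
  IsModuleTopology.continuousAlgEquivOfIsBiscalar K∞ (baseChangeAlgEquiv K L)

end NumberField.InfiniteAdeleRing

end
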